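import Mathlib.Analysis.Calculus.ContDiff.Basic
import Mathlib.Analysis.Calculus.ContDiff.RCLike
import Mathlib.Analysis.Calculus.FDeriv.Add
import Mathlib.Analysis.Calculus.FDeriv.Comp
import HarnessLib

/-!
# The odd reflection of a `C¹` map across a hyperplane is `C¹`

Topic `Literature/Analysis/Calculus`.  Let `E`, `F` be real normed spaces, `ℓ : E →L[ℝ] ℝ` a
continuous linear functional and `v ∈ E` with `ℓ v = 1`, so that `E = ker ℓ ⊕ ℝ v`; write
`r u = u - ℓ u • v` for the projection onto the hyperplane `ker ℓ` along `v` and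
`R u = u - 2 ℓ u • v` for the reflection in it.  For a map `f`, `C¹` on an open set `U` stable
under `r` and `R`, the **odd reflection** (point reflection of the values through the values on
the hyperplane)

  `g u = f u` if `ℓ u ≥ 0`,   `g u = 2 f (r u) - f (R u)` if `ℓ u < 0`

is again `C¹` on `U`, agrees with `f` on the closed half-space `{ℓ ≥ 0}`, and has the same
derivative as `f` at the points of the hyperplane (`contDiffOn_one_of_oddReflection`,
`hasFDerivAt_of_oddReflection`; for these the normalisation `ℓ v = 1` is not even needed).  The point is the identity of linear maps
`2 L ∘ r - L ∘ R = L` (`two_smul_comp_proj_sub_comp_reflection`): the two one-sided derivatives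
agree along the hyperplane, in the normal direction as well as in the tangential ones.  (Second
derivatives do NOT match in general: the construction is `C¹` only; compare Seeley's weighted
reflections for `C^∞` extension, `SeeleyExtension.lean`.)

This is the classical device for reading a neatly embedded half-disc as half of a `C¹`-embedded
disc (Hirsch, *Differential Topology* (1976), Ch. 1 §4 and Ch. 4 §6, doubling; Munkres,
*Elementary Differential Topology* (1966), §5): intended use in the tree — the compressing disc of
a reducing curve of a trisection, extended across the central surface so as to LEAVE the
handlebody (`Literature/Topology/FourManifolds/ReducibleTrisectionNonSeparatingPi1Charts.lean`,
blueprint of the side functions).  The statements are phrased for an arbitrary `g` satisfying the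
two defining clauses (no definition is introduced).  **Everything here is proved.**

## References

* M. W. Hirsch, *Differential Topology*, GTM 33, Springer (1976), Ch. 1 §4, Ch. 4 §6.
  [HirschDT1976]
* J. R. Munkres, *Elementary Differential Topology*, Princeton (1966), §5. [Munkres1966]
-/

noncomputable section

open Set Function Filter Topology

namespace Literature.Analysis.Calculus

variable {E F : Type*} [NormedAddCommGroup E] [NormedSpace ℝ E] [NormedAddCommGroup F]
  [NormedSpace ℝ F]

/-- **The linear identity behind the odd reflection**: for a linear functional `ℓ`, a vector `v`
and any linear map `L`, `2 L (w - ℓ w • v) - L (w - (2 ℓ w) • v) = L w`. [folklore] -/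
theorem two_smul_comp_proj_sub_comp_reflection (ℓ : E →L[ℝ] ℝ) (v : E) (L : E →L[ℝ] F) :
    (2 : ℝ) • L.comp (ContinuousLinearMap.id ℝ E - ℓ.smulRight v) -
      L.comp (ContinuousLinearMap.id ℝ E - (2 : ℝ) • ℓ.smulRight v) = L := by
  ext w
  simp only [sub_apply, smul_apply, ContinuousLinearMap.comp_apply,
    ContinuousLinearMap.id_apply, ContinuousLinearMap.smulRight_apply, map_sub, map_smul]
  simp only [smul_sub, smul_smul]
  abel_nf
  module

/-- The projection `r u = u - ℓ u • v` fixes the hyperplane `{ℓ = 0}`. [folklore] -/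
theorem proj_eq_self_of_apply_eq_zero (ℓ : E →L[ℝ] ℝ) (v : E) {u : E} (hu : ℓ u = 0) :
    u - ℓ u • v = u := by
  rw [hu, zero_smul, sub_zero]

/-- The reflection `R u = u - 2 ℓ u • v` fixes the hyperplane `{ℓ = 0}`. [folklore] -/
theorem reflection_eq_self_of_apply_eq_zero (ℓ : E →L[ℝ] ℝ) (v : E) {u : E} (hu : ℓ u = 0) :
    u - (2 * ℓ u) • v = u := by
  rw [hu, mul_zero, zero_smul, sub_zero]

section OddReflection

variable {ℓ : E →L[ℝ] ℝ} {v : E} {f g : E → F} {U : Set E}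

/-- The reflected branch `u ↦ 2 f (r u) - f (R u)` has derivative
`2 f′(r u) ∘ r - f′(R u) ∘ R`. [folklore] -/
theorem hasFDerivAt_reflectedBranch (hU : IsOpen U)
    (hUr : ∀ u ∈ U, u - ℓ u • v ∈ U) (hUR : ∀ u ∈ U, u - (2 * ℓ u) • v ∈ U)
    (hf : ContDiffOn ℝ 1 f U) {u : E} (hu : u ∈ U) :
    HasFDerivAt (fun w => (2 : ℝ) • f (w - ℓ w • v) - f (w - (2 * ℓ w) • v))
      ((2 : ℝ) • (fderiv ℝ f (u - ℓ u • v)).comp (ContinuousLinearMap.id ℝ E - ℓ.smulRight v) -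
        (fderiv ℝ f (u - (2 * ℓ u) • v)).comp
          (ContinuousLinearMap.id ℝ E - (2 : ℝ) • ℓ.smulRight v)) u := by
  have hfd : ∀ w ∈ U, HasFDerivAt f (fderiv ℝ f w) w := fun w hw =>
    ((hf.differentiableOn one_ne_zero) w hw).differentiableAt (hU.mem_nhds hw) |>.hasFDerivAt
  -- the two affine maps
  have hr : HasFDerivAt (fun w : E => w - ℓ w • v) (ContinuousLinearMap.id ℝ E - ℓ.smulRight v) u := by
    have h1 : HasFDerivAt (fun w : E => ℓ w • v) (ℓ.smulRight v) u := by
      simpa using (ℓ.hasFDerivAt (x := u)).smul_const v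
    exact (hasFDerivAt_id u).sub h1
  have hR : HasFDerivAt (fun w : E => w - (2 * ℓ w) • v)
      (ContinuousLinearMap.id ℝ E - (2 : ℝ) • ℓ.smulRight v) u := by
    have h1 : HasFDerivAt (fun w : E => (2 * ℓ w) • v) ((2 : ℝ) • ℓ.smulRight v) u := by
      have h2 : HasFDerivAt (fun w : E => 2 * ℓ w) ((2 : ℝ) • ℓ) u := by
        simpa using (ℓ.hasFDerivAt (x := u)).const_mul (2 : ℝ)
      have := h2.smul_const v
      convert this using 1
      ext w
      simp [mul_smul]
    exact (hasFDerivAt_id u).sub h1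
  exact (((hfd _ (hUr u hu)).comp u hr).const_smul (2 : ℝ)).sub ((hfd _ (hUR u hu)).comp u hR)

/-- **The odd reflection has, at the points of the hyperplane, the derivative of `f`.**  Here
`g` is any map with `g = f` on `{ℓ ≥ 0}` and `g u = 2 f (r u) - f (R u)` on `{ℓ < 0}`.
[cite: HirschDT1976, Ch. 1 §4] -/
theorem hasFDerivAt_of_oddReflection (hU : IsOpen U)
    (hUr : ∀ u ∈ U, u - ℓ u • v ∈ U) (hUR : ∀ u ∈ U, u - (2 * ℓ u) • v ∈ U)
    (hf : ContDiffOn ℝ 1 f U) (hg₁ : ∀ u, 0 ≤ ℓ u → g u = f u)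
    (hg₂ : ∀ u, ℓ u < 0 → g u = (2 : ℝ) • f (u - ℓ u • v) - f (u - (2 * ℓ u) • v))
    {u : E} (hu : u ∈ U) (hℓ : ℓ u = 0) : HasFDerivAt g (fderiv ℝ f u) u := by
  have hfd : HasFDerivAt f (fderiv ℝ f u) u :=
    ((hf.differentiableOn one_ne_zero) u hu).differentiableAt (hU.mem_nhds hu) |>.hasFDerivAt
  -- on the closed half-space `{ℓ ≥ 0}`, `g = f`
  have hplus : HasFDerivWithinAt g (fderiv ℝ f u) {w | 0 ≤ ℓ w} u :=
    hfd.hasFDerivWithinAt.congr (fun w hw => hg₁ w hw) (hg₁ u hℓ.ge)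
  -- on the closed half-space `{ℓ ≤ 0}`, `g` is the reflected branch, whose derivative at `u`
  -- is `2 f′(u) ∘ r - f′(u) ∘ R = f′(u)`
  have hbranch := hasFDerivAt_reflectedBranch hU hUr hUR hf hu
  rw [proj_eq_self_of_apply_eq_zero ℓ v hℓ, reflection_eq_self_of_apply_eq_zero ℓ v hℓ,
    two_smul_comp_proj_sub_comp_reflection] at hbranch
  have hminus : HasFDerivWithinAt g (fderiv ℝ f u) {w | ℓ w ≤ 0} u := by
    refine hbranch.hasFDerivWithinAt.congr (fun w hw => ?_) ?_
    · have hw' : ℓ w ≤ 0 := hw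
      rcases hw'.lt_or_eq with hlt | heq
      · exact hg₂ w hlt
      · show g w = (2 : ℝ) • f (w - ℓ w • v) - f (w - (2 * ℓ w) • v)
        rw [hg₁ w heq.ge, proj_eq_self_of_apply_eq_zero ℓ v heq,
          reflection_eq_self_of_apply_eq_zero ℓ v heq, two_smul, add_sub_cancel_right]
    · show g u = (2 : ℝ) • f (u - ℓ u • v) - f (u - (2 * ℓ u) • v)
      rw [hg₁ u hℓ.ge, proj_eq_self_of_apply_eq_zero ℓ v hℓ,
        reflection_eq_self_of_apply_eq_zero ℓ v hℓ, two_smul, add_sub_cancel_right]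
  have hunion := hplus.union hminus
  have huniv : ({w : E | 0 ≤ ℓ w} ∪ {w | ℓ w ≤ 0}) = univ :=
    eq_univ_of_forall fun w => (le_total 0 (ℓ w)).imp id id
  rw [huniv] at hunion
  exact hunion.hasFDerivAt_of_univ

/-- **The odd reflection is differentiable**, with derivative `f′` on `{ℓ ≥ 0}` and the
derivative of the reflected branch on `{ℓ < 0}`. [cite: HirschDT1976, Ch. 1 §4] -/
theorem hasFDerivAt_of_oddReflection_of_mem (hU : IsOpen U)
    (hUr : ∀ u ∈ U, u - ℓ u • v ∈ U) (hUR : ∀ u ∈ U, u - (2 * ℓ u) • v ∈ U)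
    (hf : ContDiffOn ℝ 1 f U) (hg₁ : ∀ u, 0 ≤ ℓ u → g u = f u)
    (hg₂ : ∀ u, ℓ u < 0 → g u = (2 : ℝ) • f (u - ℓ u • v) - f (u - (2 * ℓ u) • v))
    {u : E} (hu : u ∈ U) :
    HasFDerivAt g (if 0 ≤ ℓ u then fderiv ℝ f u else
      (2 : ℝ) • (fderiv ℝ f (u - ℓ u • v)).comp (ContinuousLinearMap.id ℝ E - ℓ.smulRight v) -
        (fderiv ℝ f (u - (2 * ℓ u) • v)).comp
          (ContinuousLinearMap.id ℝ E - (2 : ℝ) • ℓ.smulRight v)) u := by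
  rcases lt_trichotomy (ℓ u) 0 with hlt | heq | hgt
  · rw [if_neg hlt.not_ge]
    refine (hasFDerivAt_reflectedBranch hU hUr hUR hf hu).congr_of_eventuallyEq ?_
    have hopen : IsOpen {w : E | ℓ w < 0} := isOpen_lt ℓ.continuous continuous_const
    filter_upwards [hopen.mem_nhds hlt] with w hw
    exact hg₂ w hw
  · rw [if_pos heq.ge]
    exact hasFDerivAt_of_oddReflection hU hUr hUR hf hg₁ hg₂ hu heq
  · rw [if_pos hgt.le]
    have hfd : HasFDerivAt f (fderiv ℝ f u) u :=
      ((hf.differentiableOn one_ne_zero) u hu).differentiableAt (hU.mem_nhds hu) |>.hasFDerivAt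
    refine hfd.congr_of_eventuallyEq ?_
    have hopen : IsOpen {w : E | 0 < ℓ w} := isOpen_lt continuous_const ℓ.continuous
    filter_upwards [hopen.mem_nhds hgt] with w hw
    exact hg₁ w hw.le

/-- **The odd reflection of a `C¹` map across a hyperplane is `C¹`.**  With `ℓ v = 1`, `U` open
and stable under the projection `r` and the reflection `R`, `f` of class `C¹` on `U`, and `g` the
odd reflection (`g = f` on `{ℓ ≥ 0}`, `g u = 2 f (r u) - f (R u)` on `{ℓ < 0}`): `g` is `C¹` on
`U`.  Proof: `g` is differentiable on `U` (`hasFDerivAt_of_oddReflection_of_mem`) and its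
derivative is continuous: on each of the two closed half-spaces it is given by a continuous
formula (`f′`, resp. `2 f′(r ·) ∘ r - f′(R ·) ∘ R`), and the two formulas agree on the
hyperplane by `two_smul_comp_proj_sub_comp_reflection`. [cite: HirschDT1976, Ch. 1 §4] -/
theorem contDiffOn_one_of_oddReflection (hU : IsOpen U)
    (hUr : ∀ u ∈ U, u - ℓ u • v ∈ U) (hUR : ∀ u ∈ U, u - (2 * ℓ u) • v ∈ U)
    (hf : ContDiffOn ℝ 1 f U) (hg₁ : ∀ u, 0 ≤ ℓ u → g u = f u)
    (hg₂ : ∀ u, ℓ u < 0 → g u = (2 : ℝ) • f (u - ℓ u • v) - f (u - (2 * ℓ u) • v)) :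
    ContDiffOn ℝ 1 g U := by
  -- the two derivative formulas
  set r : E →L[ℝ] E := ContinuousLinearMap.id ℝ E - ℓ.smulRight v with hr
  set Rf : E →L[ℝ] E := ContinuousLinearMap.id ℝ E - (2 : ℝ) • ℓ.smulRight v with hRf
  set G₂ : E → E →L[ℝ] F := fun u =>
    (2 : ℝ) • (fderiv ℝ f (u - ℓ u • v)).comp r - (fderiv ℝ f (u - (2 * ℓ u) • v)).comp Rf
    with hG₂
  have hderiv : ∀ u ∈ U, HasFDerivAt g (if 0 ≤ ℓ u then fderiv ℝ f u else G₂ u) u := fun u hu =>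
    hasFDerivAt_of_oddReflection_of_mem hU hUr hUR hf hg₁ hg₂ hu
  have hdiff : DifferentiableOn ℝ g U := fun u hu => (hderiv u hu).differentiableAt.differentiableWithinAt
  have hfderiv : ∀ u ∈ U, fderiv ℝ g u = if 0 ≤ ℓ u then fderiv ℝ f u else G₂ u := fun u hu =>
    (hderiv u hu).fderiv
  -- continuity of the two formulas on `U`
  have hfc : ContinuousOn (fderiv ℝ f) U := hf.continuousOn_fderiv_of_isOpen hU le_rfl
  have hG₂c : ContinuousOn G₂ U := by
    have hrc : Continuous fun u : E => u - ℓ u • v := continuous_id.sub (ℓ.continuous.smul continuous_const)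
    have hRc : Continuous fun u : E => u - (2 * ℓ u) • v :=
      continuous_id.sub ((continuous_const.mul ℓ.continuous).smul continuous_const)
    have h1 : ContinuousOn (fun u => (fderiv ℝ f (u - ℓ u • v)).comp r) U :=
      ((ContinuousLinearMap.compL ℝ E E F).flip r).continuous.comp_continuousOn
        (hfc.comp hrc.continuousOn hUr)
    have h2 : ContinuousOn (fun u => (fderiv ℝ f (u - (2 * ℓ u) • v)).comp Rf) U :=
      ((ContinuousLinearMap.compL ℝ E E F).flip Rf).continuous.comp_continuousOn
        (hfc.comp hRc.continuousOn hUR)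
    exact (h1.const_smul (2 : ℝ)).sub h2
  -- on the hyperplane the two formulas agree
  have hagree : ∀ u, ℓ u = 0 → G₂ u = fderiv ℝ f u := fun u hu => by
    simp only [hG₂, proj_eq_self_of_apply_eq_zero ℓ v hu, reflection_eq_self_of_apply_eq_zero ℓ v hu]
    exact two_smul_comp_proj_sub_comp_reflection ℓ v _
  have hcont : ContinuousOn (fderiv ℝ g) U := by
    intro u hu
    have hCplus : IsClosed {w : E | 0 ≤ ℓ w} := isClosed_le continuous_const ℓ.continuous
    have hCminus : IsClosed {w : E | ℓ w ≤ 0} := isClosed_le ℓ.continuous continuous_const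
    -- on the closed half `{ℓ ≥ 0}` the derivative is `f′`
    have hplus : ContinuousWithinAt (fderiv ℝ g) (U ∩ {w | 0 ≤ ℓ w}) u := by
      by_cases h : 0 ≤ ℓ u
      · refine ((hfc u hu).mono inter_subset_left).congr (fun w hw => ?_) ?_
        · rw [hfderiv w hw.1, if_pos (show 0 ≤ ℓ w from hw.2)]
        · rw [hfderiv u hu, if_pos h]
      · refine continuousWithinAt_of_notMem_closure fun hmem => h ?_
        exact (closure_minimal inter_subset_right hCplus) hmem
    -- on the closed half `{ℓ ≤ 0}` it is `G₂` (on the hyperplane the two agree)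
    have hminus : ContinuousWithinAt (fderiv ℝ g) (U ∩ {w | ℓ w ≤ 0}) u := by
      by_cases h : ℓ u ≤ 0
      · refine ((hG₂c u hu).mono inter_subset_left).congr (fun w hw => ?_) ?_
        · rw [hfderiv w hw.1]
          split_ifs with h'
          · exact (hagree w (le_antisymm hw.2 h')).symm
          · rfl
        · rw [hfderiv u hu]
          split_ifs with h'
          · exact (hagree u (le_antisymm h h')).symm
          · rfl
      · refine continuousWithinAt_of_notMem_closure fun hmem => h ?_
        exact (closure_minimal inter_subset_right hCminus) hmem
    have hunion := hplus.union hminus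
    have hset : U ∩ {w : E | 0 ≤ ℓ w} ∪ U ∩ {w | ℓ w ≤ 0} = U := by
      rw [← inter_union_distrib_left]
      have huniv : ({w : E | 0 ≤ ℓ w} ∪ {w | ℓ w ≤ 0}) = univ :=
        eq_univ_of_forall fun w => (le_total 0 (ℓ w)).imp id id
      rw [huniv, inter_univ]
    rwa [hset] at hunion
  -- assemble `C¹`
  have h01 : (1 : WithTop ℕ∞) = 0 + 1 := by norm_num
  rw [h01, contDiffOn_succ_iff_fderiv_of_isOpen hU]
  exact ⟨hdiff, fun h => absurd h (by simp), contDiffOn_zero.2 hcont⟩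

/-- On the closed half-space `{ℓ ≥ 0}` the odd reflection has the derivative of `f` (in
particular along the hyperplane, where this is the common value of the two one-sided
derivatives). [cite: HirschDT1976, Ch. 1 §4] -/
theorem fderiv_oddReflection_of_nonneg (hU : IsOpen U)
    (hUr : ∀ u ∈ U, u - ℓ u • v ∈ U) (hUR : ∀ u ∈ U, u - (2 * ℓ u) • v ∈ U)
    (hf : ContDiffOn ℝ 1 f U) (hg₁ : ∀ u, 0 ≤ ℓ u → g u = f u)
    (hg₂ : ∀ u, ℓ u < 0 → g u = (2 : ℝ) • f (u - ℓ u • v) - f (u - (2 * ℓ u) • v))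
    {u : E} (hu : u ∈ U) (hℓ : 0 ≤ ℓ u) : fderiv ℝ g u = fderiv ℝ f u := by
  have h := (hasFDerivAt_of_oddReflection_of_mem hU hUr hUR hf hg₁ hg₂ hu).fderiv
  rwa [if_pos hℓ] at h

/-- On the open half-space `{ℓ < 0}` the values of the odd reflection have the opposite
`ℓ′`-sign pattern built in: if a real-valued `f` vanishes on the hyperplane piece
`U ∩ {ℓ = 0}`, then `g = -f ∘ R` there (the case used for a boundary-defining coordinate: the
reflected half-disc leaves the half-space `{f ≥ 0}`). [cite: HirschDT1976, Ch. 1 §4] -/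
theorem oddReflection_eq_neg_of_vanishing {f g : E → ℝ}
    (hf0 : ∀ u ∈ U, ℓ u = 0 → f u = 0) (hUr : ∀ u ∈ U, u - ℓ u • v ∈ U) (hv : ℓ v = 1)
    (hg₂ : ∀ u, ℓ u < 0 → g u = (2 : ℝ) • f (u - ℓ u • v) - f (u - (2 * ℓ u) • v))
    {u : E} (hu : u ∈ U) (hℓ : ℓ u < 0) : g u = -f (u - (2 * ℓ u) • v) := by
  have hr0 : ℓ (u - ℓ u • v) = 0 := by rw [map_sub, map_smul, hv, smul_eq_mul, mul_one, sub_self]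
  rw [hg₂ u hℓ, hf0 _ (hUr u hu) hr0, smul_zero, zero_sub]

end OddReflection

end Literature.Analysis.Calculus

end
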